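import Summits.QuantumFields.BalabanUV.T4Continuum.Support.NE3CovLiftCurl
import Summits.QuantumFields.BalabanUV.T4Continuum.Support.NE3CovariantWeitzenbock
import Summits.QuantumFields.BalabanUV.T4Continuum.Support.NE3CoercivityScaling
import HarnessLib

/-!
# NE7FlatCurvedPointwise — FLAT ∕ CURVED POINTWISE COMPARISONS OF THE BACKWARD DIVERGENCE AND OF THE GAUGE DIRECTION AT A NEAR-FLAT UNITARY BACKGROUND:
# `‖div_V Y(x) − div Y(x)‖ ≤ 2d·δ·s` and `‖D_Vλ(x,μ) + dλ(x,μ)‖ ≤ 2δ·‖λ(x)‖` when `‖V(x,μ) − 1‖ ≤ δ` on the bonds at `x`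
# (the divergence ∕ gauge-direction twins of `NE3CovLiftCurl.norm_curlAt_sub_flat_le`; memo ROAD-G100 §4 FILES «flat∕curved pointwise comparisons»)

Cell `pub-balaban`, rung (B)+1 sub-cell t4, lineage `b2b-balaban-t4-ne7b-p1`, generation 150 (OWNER of BINDER row NE7b; junction service for the NE crew, ruling R-OWNER-149-1 (2)).
A JUNCTION for row NE7 (node U5): memo `t4/b2b-balaban-t4-ne7-p1-g100/ROAD-G100.md` §4, steps (2)–(5): in the local axial gauge `g` on the ball (`‖W^g(b) − 1‖ ≤ a₀∕M`) the bootstrap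
compares the CURVED first-order operators at `W^g` with the FLAT ones of the fresh torus — «`‖(∂₁^* − D^*_{W^g})·‖ ≤ 2d(a₀∕M)S₀`», «`curl₁` vs `curl_{W^u}` differ by `O(a₀∕M)S₀`».  IN THE
TREE ALREADY (cite, do not restate): the curl comparison `NE3CovLiftCurl.norm_curlAt_sub_flat_le` (`≤ 16δs`) and covariance `NE3CovLiftCurl.curlAt_gaugeAct`; the divergence's covariance
`NE3.SlicePoincareSlicB8Gauge.covDiv_gaugeAct` (`covDiv (W^u) (ψ^u) x = Ad_{u x}(covDiv W ψ x)`, cell pub-balaban-gaps, `Spine/NE3/`); the gauge direction's covariance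
`NE3CpushGaugeCovariance.gaugeDir_gaugeAct` and flat form `NE3TangentCovariantTower.gaugeDir_flat` ∕ `NE3FrameFreeSliceUnique.gaugeDir_flatCfg_eq_neg_dPot`; the straight-average
comparison `NE3QbarIterCovLift.norm_QbarIter_sub_linQIter_le`.  THIS FILE adds the two missing near-flat comparisons: the backward divergence (`div_V Y − div Y = Σ_μ (Ad_{V(x,μ)} − 1)Y(x,μ)`,
`AveragingDeficitNearIdentity.norm_Ad_sub_le`) and the gauge direction (`D_Vλ + dλ = (Ad_{V(x,μ)⁻¹} − 1)λ(x)`, `NE3QbarNearFlat.norm_units_inv_sub_one_le'`).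
WHAT ([folklore]; 0 def, 0 sorry; every `d`; identities for every `V`, bounds for unitary `V`).
§1 `covDiv_sub_flatDiv`, **`norm_covDiv_sub_flatDiv_le`** (`‖V(x,μ) − 1‖ ≤ δ`, `‖Y(x,μ)‖ ≤ s` for all `μ` ⟹ `‖covDiv V Y x − flatDiv Y x‖ ≤ d·(2δs)`);
§2 `gaugeDir_add_dPot`, **`norm_gaugeDir_add_dPot_le`** (`‖V(x,μ) − 1‖ ≤ δ` ⟹ `‖gaugeDir V λ x μ + dPot λ x μ‖ ≤ 2δ·‖λ x‖`), `norm_gaugeDir_le_near_flat` (`≤ ‖dPot λ x μ‖ + 2δ‖λ x‖`).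
HONEST FRAMING (page 1): pointwise algebra + triangle inequality over the tree's definitions; nothing of Bałaban's asserted; NOT the curved letter, NOT (S1), NOT NE7, nothing of row NE7b;
spine 0∕9; finite T⁴ rung (B)+1 — NOT infinite volume, NOT mass gap, NOT BetaPertH, NOT Clay.  Continuum YM on T⁴ ⇐ BetaPertH ∧ nine spine estimates (0/9 proved); BetaPertH ⇐ (D1) ∧ (D4) ∧
CAP+tail; G-an2-4 gates asym, D1 and NE2/3/4.
-/

set_option autoImplicit false

open scoped BigOperators Matrix.Norms.L2Operator
open Finset

namespace Summit.QuantumFields.BalabanUV.T4Continuum.NE7FlatCurvedPointwise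

open Literature.MathematicalPhysics.QuantumFieldTheory.Balaban1983to89
open B7Prop1Explicit B7Prop2Explicit
open T4AveragingDeficitWall (IsUnitaryCfg Ad)
open AveragingDeficitNearIdentity (norm_Ad_sub_le)
open BlockAveragePushDirGauge (gaugeDir)
open NE3TangentNoGoWords (dPot)
open NE3CovariantWeitzenbock (covDiv)
open NE3CoercivityScaling (flatDiv)
open NE3QbarNearFlat (norm_units_inv_sub_one_le')

noncomputable section

variable {d : ℕ} {n : Type*} [Fintype n] [DecidableEq n]

/-! ## §1 The backward divergence: curved vs flat -/

/-- `div_V Y(x) − div Y(x) = Σ_μ (Ad_{V(x,μ)} Y(x,μ) − Y(x,μ))`. [folklore] -/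
theorem covDiv_sub_flatDiv (V : Site d → Fin d → (Matrix n n ℂ)ˣ) (Y : Site d → Fin d → Matrix n n ℂ) (x : Site d) :
    covDiv V Y x - flatDiv Y x = ∑ μ : Fin d, (Ad (V x μ) (Y x μ) - Y x μ) := by
  simp only [covDiv, flatDiv, ← Finset.sum_sub_distrib]
  refine Finset.sum_congr rfl fun μ _ => ?_
  abel

/-- **THE CURVED BACKWARD DIVERGENCE IS `2d·δ·s`-CLOSE TO THE FLAT ONE** (unitary `V` with `‖V(x,μ) − 1‖ ≤ δ` and `‖Y(x,μ)‖ ≤ s` for every `μ`). [folklore] -/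
theorem norm_covDiv_sub_flatDiv_le [Nonempty n] {V : Site d → Fin d → (Matrix n n ℂ)ˣ} (hV : IsUnitaryCfg V) (Y : Site d → Fin d → Matrix n n ℂ) (x : Site d)
    {δ s : ℝ} (hδ : ∀ μ : Fin d, ‖((V x μ : (Matrix n n ℂ)ˣ) : Matrix n n ℂ) - 1‖ ≤ δ) (hs : ∀ μ : Fin d, ‖Y x μ‖ ≤ s) :
    ‖covDiv V Y x - flatDiv Y x‖ ≤ d * (2 * δ * s) := by
  rw [covDiv_sub_flatDiv]
  calc ‖∑ μ : Fin d, (Ad (V x μ) (Y x μ) - Y x μ)‖ ≤ ∑ μ : Fin d, ‖Ad (V x μ) (Y x μ) - Y x μ‖ := norm_sum_le _ _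
    _ ≤ ∑ _μ : Fin d, 2 * δ * s := Finset.sum_le_sum fun μ _ => by
        have hδ0 : 0 ≤ δ := (norm_nonneg _).trans (hδ μ)
        exact (norm_Ad_sub_le (hV x μ) (Y x μ)).trans
          (mul_le_mul (mul_le_mul_of_nonneg_left (hδ μ) (by norm_num)) (hs μ) (norm_nonneg _) (by positivity))
    _ = d * (2 * δ * s) := by rw [Finset.sum_const, Finset.card_univ, Fintype.card_fin, nsmul_eq_mul]

/-! ## §2 The gauge direction: curved vs flat -/

/-- `D_Vλ(x,μ) + dλ(x,μ) = Ad_{V(x,μ)⁻¹} λ(x) − λ(x)` (`gaugeDir V λ x μ = Ad_{V(x,μ)⁻¹}λ(x) − λ(x+e_μ)`, `dPot λ x μ = λ(x+e_μ) − λ(x)`). [folklore] -/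
theorem gaugeDir_add_dPot (V : Site d → Fin d → (Matrix n n ℂ)ˣ) (lam : Site d → Matrix n n ℂ) (x : Site d) (μ : Fin d) :
    gaugeDir V lam x μ + dPot lam x μ = Ad (V x μ)⁻¹ (lam x) - lam x := by
  simp only [gaugeDir, dPot]
  abel

/-- **THE CURVED GAUGE DIRECTION IS `2δ‖λ(x)‖`-CLOSE TO MINUS THE FLAT GRADIENT** (unitary `V`, `‖V(x,μ) − 1‖ ≤ δ`). [folklore] -/
theorem norm_gaugeDir_add_dPot_le [Nonempty n] {V : Site d → Fin d → (Matrix n n ℂ)ˣ} (hV : IsUnitaryCfg V) (lam : Site d → Matrix n n ℂ) (x : Site d)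
    (μ : Fin d) {δ : ℝ} (hδ : ‖((V x μ : (Matrix n n ℂ)ˣ) : Matrix n n ℂ) - 1‖ ≤ δ) :
    ‖gaugeDir V lam x μ + dPot lam x μ‖ ≤ 2 * δ * ‖lam x‖ := by
  have hinv : (V x μ)⁻¹ ∈ unitaryUnits (Matrix n n ℂ) := (unitaryUnits _).inv_mem (hV x μ)
  have hδ' : ‖(((V x μ)⁻¹ : (Matrix n n ℂ)ˣ) : Matrix n n ℂ) - 1‖ ≤ δ := (norm_units_inv_sub_one_le' (hV x μ)).trans hδ
  rw [gaugeDir_add_dPot]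
  exact (norm_Ad_sub_le hinv (lam x)).trans (mul_le_mul_of_nonneg_right (mul_le_mul_of_nonneg_left hδ' (by norm_num)) (norm_nonneg _))

/-- The curved gauge direction near the flat background: `‖D_Vλ(x,μ)‖ ≤ ‖dλ(x,μ)‖ + 2δ‖λ(x)‖`. [folklore] -/
theorem norm_gaugeDir_le_near_flat [Nonempty n] {V : Site d → Fin d → (Matrix n n ℂ)ˣ} (hV : IsUnitaryCfg V) (lam : Site d → Matrix n n ℂ) (x : Site d)
    (μ : Fin d) {δ : ℝ} (hδ : ‖((V x μ : (Matrix n n ℂ)ˣ) : Matrix n n ℂ) - 1‖ ≤ δ) :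
    ‖gaugeDir V lam x μ‖ ≤ ‖dPot lam x μ‖ + 2 * δ * ‖lam x‖ := by
  have h := norm_gaugeDir_add_dPot_le hV lam x μ hδ
  have e : gaugeDir V lam x μ = (gaugeDir V lam x μ + dPot lam x μ) - dPot lam x μ := by abel
  rw [e]
  calc ‖gaugeDir V lam x μ + dPot lam x μ - dPot lam x μ‖ ≤ ‖gaugeDir V lam x μ + dPot lam x μ‖ + ‖dPot lam x μ‖ := norm_sub_le _ _
    _ ≤ 2 * δ * ‖lam x‖ + ‖dPot lam x μ‖ := add_le_add h le_rfl
    _ = ‖dPot lam x μ‖ + 2 * δ * ‖lam x‖ := add_comm _ _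

end

end Summit.QuantumFields.BalabanUV.T4Continuum.NE7FlatCurvedPointwise
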